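import Summits.AtomisticToContinuum.HydrodynamicLimit.Theorems.LambertianContactSwapLambertianEulerCellChargingCount
import Summits.AtomisticToContinuum.HydrodynamicLimit.Theorems.LambertianContactSwapLambertianEulerCellChargingFlight
import HarnessLib

/-!
# Cellwise fresh / non-fresh charging of the Lambertian collision sequence: the pathwise inequality
# (`LambertianContactSwap.LambertianEuler`, stmt-AtomisticToContinuum-11854, line `Sketch`; lead c10,
# piece W7 `CellCharging`, part 3 of 4: registered helper stub `windowCount_le_of_noRecollision`)

Notation as in `…CellChargingCount`, `…CellChargingFlight`: `t_k = lambertInstant`, `K_s = lambertCount`,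
`z_k = lambertStateAfter`, `Λ_s = lambertFlow`, `z_k♭` the exit configuration of collision `k + 1`
(time `t_{k+1}`), `p_k` its incoming pair.  The velocity SHELL of width `δ` of a pair `(i, j)` of a
configuration `y` is `ε ≤ d(y_i, y_j) ≤ ε + δ ‖v_i - v_j‖`.

* `windowCount_le_of_noRecollision`: in a geometry whose separation is Lipschitz along translations
  and symmetric in norm, on a simple (`τ_k > 0`), non-accumulating Lambertian path with simple
  incoming exits, given the "no fast re-collision below `L` within time `δ`" hypothesis and a mark
  `mark q y ≥ 0` which is `≥ 1` when a third particle lies in the `δ`-shell of `q.1` or `q.2` in `y`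
  or when `L ≤ δ ‖v_{q.1} - v_{q.2}‖`: for cells `(a' + jδ, a' + (j+1)δ]`, `j < J`,
  `K_{a'+Jδ} - K_{a'} ≤ Σ_{j<J} #{ordered shell pairs of Λ_{a'+jδ}}
    + 3 Σ_{m<K_{a'+Jδ}, a'<t_{m+1}} Σ_q 𝟙{q ∈ incomingPairs z_m♭} mark q z_m♭`.

Proof.  The counted collisions are `k₁ ≤ m < K` (`k₁ = K_{a'}`, `K = K_{a'+Jδ}`), the cell of `m` is
`⌈(t_{m+1} - a')/δ⌉ - 1` (`cell_bounds`).  Apply the counting lemma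
`…CellChargingCount.sub_le_card_add_three_mul_card` with `S` = the shell pairs `(j, q)` at the cell starts and `T` = the
counted `m` with `mark p_m z_m♭ ≥ 1`: (A) a FRESH `m` (no earlier collision of its cell involves a
particle of `p_m`) has both particles flying freely from the cell start `s = a' + jδ`
(`exit_apply_of_free` from the segment of `s`, `lambertFlow_segment_data`) for a time `≤ δ` to
contact, so `p_m` is a shell pair of `Λ_s`; (B1) `a ∈ p_m` collided last at `m'` with partner `b`,
both free since: either `b ∉ p_m` is a third particle in the `δ`-shell of `a` at `z_m♭`
(`norm_sepVec_exit_le_of_free`) or `p_m = p_{m'}` re-collides within `δ`, a fast pair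
(`le_mul_norm_of_recollision`); (B2) `b` collides first again at `m` without `a`: `a` is a third
particle in the `δ`-shell of `b` at `z_m♭`.  Finally `#S` is the shell sum and `#T` is at most the
marked sum (`incomingPairs z_m♭ = {p_m}`).

References: Cercignani–Illner–Pulvirenti 1994, App. 4.A; Gallagher–Saint-Raymond–Texier 2013, Ch. 4.
All statements [folklore].
-/

noncomputable section

namespace Summit.AtomisticToContinuum.HydrodynamicLimit.Theorems.LambertianContactSwapLambertianEulerCellChargingPath

open scoped BigOperators Topology ENNReal InnerProductSpace
open MeasureTheory Filter Set
open Literature.MathematicalPhysics.KineticTheory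
open Literature.Analysis.FluidPDE Literature.Analysis.FluidPDE.Alexander
open Summit.AtomisticToContinuum.HydrodynamicLimit.Theorems.LambertianContactSwapLambertianEulerKorolyuk
open Summit.AtomisticToContinuum.HydrodynamicLimit.Theorems.LambertianContactSwapLambertianEulerMarkedKorolyuk
open Summit.AtomisticToContinuum.HydrodynamicLimit.Theorems.LambertianContactSwapLambertianEulerCellChargingCount
open Summit.AtomisticToContinuum.HydrodynamicLimit.Theorems.LambertianContactSwapLambertianEulerCellChargingFlight

/-- **The cell charging inequality, pathwise** (registered helper stub of lead c10's piece W7).  In a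
geometry whose separation is Lipschitz along translations and symmetric in norm, on a simple
(`τ_k > 0`), non-accumulating Lambertian path whose exit configurations are simple incoming, with the
"no fast re-collision below `L` within time `δ`" hypothesis, and for a mark `mark q y ≥ 0` which is
`≥ 1` whenever a third particle `r` lies in the `δ`-shell of `q.1` or of `q.2` in `y`, or
`L ≤ δ ‖v_{q.1} - v_{q.2}‖`: for `a' ≥ 0` and `J` cells of width `δ`,
`K_{a'+Jδ} - K_{a'} ≤ Σ_{j<J} #{ordered shell pairs of Λ_{a'+jδ}}
  + 3 Σ_{m<K_{a'+Jδ}, a'<t_{m+1}} Σ_q 𝟙{q ∈ incomingPairs z_m♭} mark q z_m♭`. [folklore] -/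
theorem windowCount_le_of_noRecollision :
    ∀ {d : Type*} [Fintype d] {X : Type*} {N : ℕ} {G : Geometry d X} {ε : ℝ}
      {ξs : ℕ → EuclideanSpace ℝ d} {z : Config N d X},
      (∀ (x y : X) (vx vy : EuclideanSpace ℝ d) (u : ℝ), ‖G.sepVec x y‖ ≤
        ‖G.sepVec (G.translate x (u • vx)) (G.translate y (u • vy))‖ + |u| * ‖vx - vy‖) →
      (∀ (x y : X) (vx vy : EuclideanSpace ℝ d) (u : ℝ),
        ‖G.sepVec (G.translate x (u • vx)) (G.translate y (u • vy))‖ ≤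
          ‖G.sepVec x y‖ + |u| * ‖vx - vy‖) →
      (∀ x y : X, ‖G.sepVec x y‖ = ‖G.sepVec y x‖) →
      (∀ k, 0 < freeExitTime G ε (lambertStateAfter G ε ξs z k)) →
      (∀ T : ℝ, ∃ k, ENNReal.ofReal T < lambertInstant G ε ξs z k) →
      (∀ k, freeExitTime G ε (lambertStateAfter G ε ξs z k) ≠ ∞ →
        IsSimpleIncoming G ε (freeFlight G (freeExitTime G ε (lambertStateAfter G ε ξs z k)).toReal
          (lambertStateAfter G ε ξs z k))) →
      ∀ {δ L : ℝ}, 0 < δ →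
        (∀ (x y : X) (vx vy : EuclideanSpace ℝ d) (u : ℝ), 0 < u → u ≤ δ → ‖G.sepVec x y‖ = ε →
          0 ≤ ⟪G.sepVec x y, vx - vy⟫_ℝ →
          ‖G.sepVec (G.translate x (u • vx)) (G.translate y (u • vy))‖ = ε →
          ⟪G.sepVec (G.translate x (u • vx)) (G.translate y (u • vy)), vx - vy⟫_ℝ < 0 →
          L ≤ δ * ‖vx - vy‖) →
        ∀ (mark : Fin N × Fin N → Config N d X → ℝ), (∀ q y, 0 ≤ mark q y) →
          (∀ (q : Fin N × Fin N) (y : Config N d X) (r : Fin N), r ≠ q.1 → r ≠ q.2 →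
            (ε ≤ ‖G.sepVec (y q.1).1 (y r).1‖ ∧
                ‖G.sepVec (y q.1).1 (y r).1‖ ≤ ε + δ * ‖(y q.1).2 - (y r).2‖) ∨
              (ε ≤ ‖G.sepVec (y q.2).1 (y r).1‖ ∧
                ‖G.sepVec (y q.2).1 (y r).1‖ ≤ ε + δ * ‖(y q.2).2 - (y r).2‖) →
            1 ≤ mark q y) →
          (∀ (q : Fin N × Fin N) (y : Config N d X), L ≤ δ * ‖(y q.1).2 - (y q.2).2‖ →
            1 ≤ mark q y) →
          ∀ {a' : ℝ}, 0 ≤ a' → ∀ J : ℕ,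
            ((lambertCount G ε ξs z (a' + (J : ℝ) * δ) : ℕ) : ℝ) -
                ((lambertCount G ε ξs z a' : ℕ) : ℝ) ≤
              (∑ j ∈ Finset.range J, ∑ q : Fin N × Fin N,
                  if q.1 ≠ q.2 ∧
                      ε ≤ ‖G.sepVec (lambertFlow G ε ξs z (a' + (j : ℝ) * δ) q.1).1
                          (lambertFlow G ε ξs z (a' + (j : ℝ) * δ) q.2).1‖ ∧
                      ‖G.sepVec (lambertFlow G ε ξs z (a' + (j : ℝ) * δ) q.1).1
                          (lambertFlow G ε ξs z (a' + (j : ℝ) * δ) q.2).1‖ ≤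
                        ε + δ * ‖(lambertFlow G ε ξs z (a' + (j : ℝ) * δ) q.1).2 -
                          (lambertFlow G ε ξs z (a' + (j : ℝ) * δ) q.2).2‖
                    then (1 : ℝ) else 0) +
                3 * ∑ m ∈ Finset.range (lambertCount G ε ξs z (a' + (J : ℝ) * δ)),
                  if a' < (lambertInstant G ε ξs z (m + 1)).toReal then
                    ∑ q : Fin N × Fin N,
                      (incomingPairs G ε (freeFlight G
                        (freeExitTime G ε (lambertStateAfter G ε ξs z m)).toReal
                        (lambertStateAfter G ε ξs z m))).indicator
                        (fun q' => mark q' (freeFlight G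
                          (freeExitTime G ε (lambertStateAfter G ε ξs z m)).toReal
                          (lambertStateAfter G ε ξs z m))) q
                  else 0 := by
  intro d _ X N G ε ξs z hLipA hLipB hsymm hpos hacc hsimple δ L hδ hL mark hmk0 hmk1 hmk2 a' ha' J
  -- abbreviations: the real instants `t k` and the exit configurations `E k = z_k♭`
  obtain ⟨t, ht⟩ : ∃ t : ℕ → ℝ, ∀ k, t k = (lambertInstant G ε ξs z k).toReal := ⟨_, fun _ => rfl⟩
  obtain ⟨E, hE⟩ : ∃ E : ℕ → Config N d X, ∀ k, E k = freeFlight G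
      (freeExitTime G ε (lambertStateAfter G ε ξs z k)).toReal (lambertStateAfter G ε ξs z k) :=
    ⟨_, fun _ => rfl⟩
  set K := lambertCount G ε ξs z (a' + (J : ℝ) * δ) with hK
  have haJ : 0 ≤ a' + (J : ℝ) * δ := by positivity
  -- the segment of `a' + Jδ`: the instants up to `t_K` are finite reals
  obtain ⟨m₀, hm1, hm2⟩ := LRestart.exists_lambert_segment (hacc (a' + (J : ℝ) * δ)) le_rfl
  have hKm : K = m₀ := lambertCount_eq_of_segment hm1 hm2
  have htK : lambertInstant G ε ξs z K ≤ ENNReal.ofReal (a' + (J : ℝ) * δ) := by rw [hKm]; exact hm1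
  have htopK : lambertInstant G ε ξs z K ≠ ∞ := ne_top_of_le_ne_top ENNReal.ofReal_ne_top htK
  have htop : ∀ k ≤ K, lambertInstant G ε ξs z k ≠ ∞ := fun k hk =>
    ne_top_of_le_ne_top htopK (monotone_lambertInstant ξs z hk)
  have hτtop : ∀ k < K, freeExitTime G ε (lambertStateAfter G ε ξs z k) ≠ ∞ := fun k hk =>
    (toReal_lambertInstant_succ htopK hk).2
  have hlt_succ : ∀ k < K, t k < t (k + 1) := fun k hk => by
    rw [ht, ht, (toReal_lambertInstant_succ htopK hk).1]
    linarith [ENNReal.toReal_pos (hpos k).ne' (hτtop k hk)]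
  have hmono : ∀ i j, i ≤ j → j ≤ K → t i ≤ t j := fun i j hij hjK => by
    rw [ht, ht]
    exact ENNReal.toReal_mono (htop j hjK) (monotone_lambertInstant ξs z hij)
  have hsmono : ∀ i j, i < j → j ≤ K → t i < t j := fun i j hij hjK =>
    (hlt_succ i (by omega)).trans_le (hmono (i + 1) j hij hjK)
  have htle : ∀ k ≤ K, t k ≤ a' + (J : ℝ) * δ := fun k hk => by
    rw [ht]
    exact ENNReal.toReal_le_of_le_ofReal haJ ((monotone_lambertInstant ξs z hk).trans htK)
  -- the segment of `a'`: `K_{a'} = k₁ ≤ K`, the counted collisions are `k₁ ≤ m < K`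
  have haJ' : a' ≤ a' + (J : ℝ) * δ := le_add_of_nonneg_right (by positivity)
  obtain ⟨k₁, hk1, hk2⟩ := LRestart.exists_lambert_segment (hacc (a' + (J : ℝ) * δ)) haJ'
  have hKa : lambertCount G ε ξs z a' = k₁ := lambertCount_eq_of_segment hk1 hk2
  have hk₁K : k₁ ≤ K := le_lambertCount_of_lambertInstant_le (hacc _)
    (hk1.trans (ENNReal.ofReal_le_ofReal haJ'))
  have hak : ∀ m, k₁ ≤ m → m < K → a' < t (m + 1) := fun m hm hmK => by
    rw [ht]
    exact (ENNReal.ofReal_lt_iff_lt_toReal ha' (htop (m + 1) hmK)).1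
      (hk2.trans_le (monotone_lambertInstant ξs z (by omega)))
  -- reduction to `K - k₁ ≤ …`; the trivial case `K = 0`
  rw [hKa, ← Nat.cast_sub hk₁K]
  rcases Nat.eq_zero_or_pos K with hK0 | hKpos
  · rw [show K - k₁ = 0 by omega, Nat.cast_zero]
    refine add_nonneg (Finset.sum_nonneg fun j _ => Finset.sum_nonneg fun q _ => ?_)
      (mul_nonneg (by norm_num) (Finset.sum_nonneg fun m hm => ?_))
    · split_ifs <;> norm_num
    · simp [hK0] at hm
  -- the incoming pairs `p m` of the exit configurations, `m < K`
  obtain ⟨q₀, -⟩ := isSimpleIncoming_iff.1 (hsimple 0 (hτtop 0 hKpos))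
  have hex : ∀ m, ∃ q : Fin N × Fin N, m < K → IsSimpleIncomingWith G ε (E m) q := by
    intro m
    by_cases hm : m < K
    · obtain ⟨q, hq⟩ := isSimpleIncoming_iff.1 (hsimple m (hτtop m hm))
      exact ⟨q, fun _ => by rw [hE]; exact hq⟩
    · exact ⟨q₀, fun h => absurd h hm⟩
  choose p hp using hex
  have hstep : ∀ k < K, lambertStateAfter G ε ξs z (k + 1) =
      lambertPair G (p k).1 (p k).2 (E k) (ξs k) := fun k hk => by
    have h := (hp k hk).incomingPairs_eq
    rw [hE] at h
    rw [lambertStateAfter_succ, hE, lambertStep_eq_lambertPair (hτtop k hk) h]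
  -- the cells: `t_{m+1} ∈ (a' + cell m • δ, a' + (cell m + 1) δ]`, `cell m < J`, nondecreasing
  set cell : ℕ → ℕ := fun m => ⌈(t (m + 1) - a') / δ⌉₊ - 1 with hcell
  have hcnt : ∀ m, k₁ ≤ m → m < K → cell m < J ∧ a' + (cell m : ℝ) * δ < t (m + 1) ∧
      t (m + 1) ≤ a' + (cell m : ℝ) * δ + δ :=
    fun m hk₁m hmK => cell_bounds hδ (hak m hk₁m hmK) (htle (m + 1) hmK)
  have hcmono : ∀ m₁ m₂, k₁ ≤ m₁ → m₁ ≤ m₂ → m₂ < K → cell m₁ ≤ cell m₂ := by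
    intro m₁ m₂ _ h12 h2K
    have h : t (m₁ + 1) ≤ t (m₂ + 1) := hmono _ _ (by omega) (by omega)
    exact Nat.sub_le_sub_right (Nat.ceil_mono (div_le_div_of_nonneg_right (by linarith) hδ.le)) 1
  have hclose : ∀ m' m, k₁ ≤ m' → m' < m → m < K → cell m' = cell m →
      0 < t (m + 1) - t (m' + 1) ∧ t (m + 1) - t (m' + 1) < δ := by
    intro m' m h1 h2 h3 h4
    obtain ⟨-, hlo', hhi'⟩ := hcnt m' h1 (h2.trans h3)
    obtain ⟨-, hlo, hhi⟩ := hcnt m (h1.trans h2.le) h3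
    rw [h4] at hlo' hhi'
    exact ⟨sub_pos.2 (hsmono (m' + 1) (m + 1) (by omega) (by omega)), by linarith⟩
  -- the charged sets: shell pairs at the cell starts, marked counted collisions
  set S : Finset (ℕ × (Fin N × Fin N)) := (Finset.range J ×ˢ Finset.univ).filter fun jq =>
    jq.2.1 ≠ jq.2.2 ∧
      ε ≤ ‖G.sepVec (lambertFlow G ε ξs z (a' + (jq.1 : ℝ) * δ) jq.2.1).1
          (lambertFlow G ε ξs z (a' + (jq.1 : ℝ) * δ) jq.2.2).1‖ ∧
      ‖G.sepVec (lambertFlow G ε ξs z (a' + (jq.1 : ℝ) * δ) jq.2.1).1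
          (lambertFlow G ε ξs z (a' + (jq.1 : ℝ) * δ) jq.2.2).1‖ ≤
        ε + δ * ‖(lambertFlow G ε ξs z (a' + (jq.1 : ℝ) * δ) jq.2.1).2 -
          (lambertFlow G ε ξs z (a' + (jq.1 : ℝ) * δ) jq.2.2).2‖ with hS
  set T : Finset ℕ := (Finset.Ico k₁ K).filter fun m => 1 ≤ mark (p m) (E m) with hT
  -- the counting lemma
  have key : K - k₁ ≤ S.card + 3 * T.card := by
    refine sub_le_card_add_three_mul_card cell p S T hcmono (fun m _ hmK => (hp m hmK).ne)
      ?_ ?_ ?_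
    · -- (A) a fresh collision is a shell pair at the start of its cell
      intro m hk₁m hmK hfr
      obtain ⟨hcJ, hc1, hc2⟩ := hcnt m hk₁m hmK
      set s : ℝ := a' + (cell m : ℝ) * δ with hs
      have hcδ : 0 ≤ (cell m : ℝ) * δ := mul_nonneg (Nat.cast_nonneg _) hδ.le
      have hs0 : 0 ≤ s := add_nonneg ha' hcδ
      have has : a' ≤ s := le_add_of_nonneg_right hcδ
      have hsJ : s ≤ a' + (J : ℝ) * δ := by
        have h : (cell m : ℝ) ≤ (J : ℝ) := by exact_mod_cast hcJ.le
        rw [hs]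
        nlinarith
      -- the segment `t_{n₀} ≤ s < t_{n₀+1}` of the cell start, `k₁ ≤ n₀ ≤ m`
      obtain ⟨n₀, hn1, hn2⟩ := LRestart.exists_lambert_segment (hacc (a' + (J : ℝ) * δ)) hsJ
      have hn₀m : n₀ ≤ m := by
        by_contra h
        have h' : lambertInstant G ε ξs z (m + 1) ≤ ENNReal.ofReal s :=
          (monotone_lambertInstant ξs z (by omega)).trans hn1
        have h'' : t (m + 1) ≤ s := by rw [ht]; exact ENNReal.toReal_le_of_le_ofReal hs0 h'
        linarith
      have hk₁n₀ : k₁ ≤ n₀ := by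
        by_contra h
        have h' : ENNReal.ofReal s < ENNReal.ofReal a' :=
          hn2.trans_le ((monotone_lambertInstant ξs z (by omega)).trans hk1)
        rw [ENNReal.ofReal_lt_ofReal_iff_of_nonneg hs0] at h'
        linarith
      have hn₀K : n₀ + 1 ≤ K := by omega
      have h1' : (lambertInstant G ε ξs z n₀).toReal ≤ s := ENNReal.toReal_le_of_le_ofReal hs0 hn1
      have h2' : s < (lambertInstant G ε ξs z (n₀ + 1)).toReal :=
        (ENNReal.ofReal_lt_iff_lt_toReal hs0 (htop (n₀ + 1) hn₀K)).1 hn2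
      obtain ⟨hflow, hyD, -, -⟩ :=
        lambertFlow_segment_data hs0 (htop n₀ (by omega)) (htop (n₀ + 1) hn₀K) h1' h2'
      rw [← ht] at h2'
      -- the particles of `p m` take part in no collision `n₀ ≤ n < m` (freshness)
      have hfree : ∀ a, (a = (p m).1 ∨ a = (p m).2) →
          ∀ n, n₀ ≤ n → n < m → a ≠ (p n).1 ∧ a ≠ (p n).2 := by
        intro a ha n hn1' hn2'
        have hcelln : cell n = cell m :=
          cell_eq_of_mem hδ (h2'.trans_le (hmono (n₀ + 1) (n + 1) (by omega) (by omega)))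
            ((hmono (n + 1) (m + 1) (by omega) (by omega)).trans hc2)
        have h := hfr n (hk₁n₀.trans hn1') hn2' hcelln
        rcases ha with rfl | rfl
        · exact ⟨h.1, h.2.1⟩
        · exact ⟨h.2.2.1, h.2.2.2⟩
      -- so both flew freely from `Λ_s` for the time `t_{m+1} - s ∈ (0, δ]` to contact
      have hΛ : ∀ a, lambertFlow G ε ξs z s a = (G.translate (lambertStateAfter G ε ξs z n₀ a).1
          ((s - t n₀) • (lambertStateAfter G ε ξs z n₀ a).2), (lambertStateAfter G ε ξs z n₀ a).2) :=
        fun a => by rw [hflow, freeFlight_apply, ht]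
      have hfly : ∀ a, (a = (p m).1 ∨ a = (p m).2) →
          (G.translate (lambertFlow G ε ξs z s a).1
              ((t (m + 1) - s) • (lambertFlow G ε ξs z s a).2),
            (lambertFlow G ε ξs z s a).2) = E m a := by
        intro a ha
        rw [exit_apply_of_free ht hE htopK hstep hn₀m hmK (hfree a ha), hΛ a]
        dsimp only
        rw [Geometry.translate_add, ← add_smul,
          show s - t n₀ + (t (m + 1) - s) = t (m + 1) - t n₀ by ring]
      have hu0 : 0 ≤ t (m + 1) - s := by linarith
      have huδ : t (m + 1) - s ≤ δ := by linarith
      have hup : ‖G.sepVec (lambertFlow G ε ξs z s (p m).1).1 (lambertFlow G ε ξs z s (p m).2).1‖ ≤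
          ε + δ * ‖(lambertFlow G ε ξs z s (p m).1).2 - (lambertFlow G ε ξs z s (p m).2).2‖ := by
        have h := hLipA (lambertFlow G ε ξs z s (p m).1).1 (lambertFlow G ε ξs z s (p m).2).1
          (lambertFlow G ε ξs z s (p m).1).2 (lambertFlow G ε ξs z s (p m).2).2 (t (m + 1) - s)
        have hc : ‖G.sepVec (E m (p m).1).1 (E m (p m).2).1‖ = ε := (hp m hmK).mem_contactSet.2
        rw [← hfly _ (Or.inl rfl), ← hfly _ (Or.inr rfl)] at hc
        dsimp only at hc
        rw [hc, abs_of_nonneg hu0] at h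
        have hmul : (t (m + 1) - s) *
            ‖(lambertFlow G ε ξs z s (p m).1).2 - (lambertFlow G ε ξs z s (p m).2).2‖ ≤
            δ * ‖(lambertFlow G ε ξs z s (p m).1).2 - (lambertFlow G ε ξs z s (p m).2).2‖ :=
          mul_le_mul_of_nonneg_right huδ (norm_nonneg _)
        linarith
      have hlow : ε ≤ ‖G.sepVec (lambertFlow G ε ξs z s (p m).1).1
          (lambertFlow G ε ξs z s (p m).2).1‖ := hyD _ _ (hp m hmK).ne
      rw [hS, Finset.mem_filter, Finset.mem_product, Finset.mem_range]
      exact ⟨⟨hcJ, Finset.mem_univ _⟩, (hp m hmK).ne, hlow, hup⟩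
    · -- (B1) a particle `a` of `p m` collided last at `m'` with partner `b`; both free since
      intro m' m a b hk₁m' hm'm hmK hcl hab ha hfa hfb
      rw [hT, Finset.mem_filter, Finset.mem_Ico]
      refine ⟨⟨by omega, hmK⟩, ?_⟩
      obtain ⟨hu0, huδ⟩ := hclose m' m hk₁m' hm'm hmK hcl
      by_cases hbm : b = (p m).1 ∨ b = (p m).2
      · -- the same pair re-collides within time `δ`: it is fast
        have hpm : p m = p m' := by
          have hlt := (hp m hmK).1
          have hlt' := (hp m' (hm'm.trans hmK)).1
          rw [Fin.lt_def] at hlt hlt'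
          rcases hab with ⟨ha', hb'⟩ | ⟨ha', hb'⟩ <;> rcases ha with ha | ha <;>
            rcases hbm with hb | hb <;>
            · rw [Fin.ext_iff] at ha' hb' ha hb
              exact Prod.ext (Fin.ext (by omega)) (Fin.ext (by omega))
        have hf1 : ∀ n, m' < n → n < m → (p m).1 ≠ (p n).1 ∧ (p m).1 ≠ (p n).2 := by
          rcases hab with ⟨ha', hb'⟩ | ⟨ha', hb'⟩
          · rw [hpm, ← ha']; exact hfa
          · rw [hpm, ← hb']; exact hfb
        have hf2 : ∀ n, m' < n → n < m → (p m).2 ≠ (p n).1 ∧ (p m).2 ≠ (p n).2 := by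
          rcases hab with ⟨ha', hb'⟩ | ⟨ha', hb'⟩
          · rw [hpm, ← hb']; exact hfb
          · rw [hpm, ← ha']; exact hfa
        exact hmk2 _ _ (le_mul_norm_of_recollision hL ht hE htopK hstep hp hm'm hmK hpm hu0 huδ.le
          hf1 hf2)
      · -- the partner `b` is a third particle in the `δ`-shell of `a` at `z_m♭`
        rw [not_or] at hbm
        have hab' : a ≠ b := by
          rcases ha with rfl | rfl
          · exact fun h => hbm.1 h.symm
          · exact fun h => hbm.2 h.symm
        have hsh := norm_sepVec_exit_le_of_free hLipB hsymm ht hE htopK hstep hp hm'm hmK hab hfa hfb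
        rw [abs_of_pos hu0] at hsh
        have hmul : (t (m + 1) - t (m' + 1)) * ‖(E m a).2 - (E m b).2‖ ≤
            δ * ‖(E m a).2 - (E m b).2‖ := mul_le_mul_of_nonneg_right huδ.le (norm_nonneg _)
        have hlow : ε ≤ ‖G.sepVec (E m a).1 (E m b).1‖ := (hp m hmK).mem_hardSphereDomain a b hab'
        refine hmk1 (p m) (E m) b hbm.1 hbm.2 ?_
        rcases ha with rfl | rfl
        · exact Or.inl ⟨hlow, by linarith⟩
        · exact Or.inr ⟨hlow, by linarith⟩
    · -- (B2) `b` collides first again at `m` without its old partner `a`: `a` is a third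
      -- particle in the `δ`-shell of `b` at `z_m♭`
      intro m' m a b hk₁m' hm'm hmK hcl hab hb ha1 ha2 hfa hfb
      rw [hT, Finset.mem_filter, Finset.mem_Ico]
      refine ⟨⟨by omega, hmK⟩, ?_⟩
      obtain ⟨hu0, huδ⟩ := hclose m' m hk₁m' hm'm hmK hcl
      have hba : b = (p m').1 ∧ a = (p m').2 ∨ b = (p m').2 ∧ a = (p m').1 := by
        rcases hab with ⟨h1, h2⟩ | ⟨h1, h2⟩
        · exact Or.inr ⟨h2, h1⟩
        · exact Or.inl ⟨h2, h1⟩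
      have hba' : b ≠ a := by
        rcases hb with rfl | rfl
        · exact fun h => ha1 h.symm
        · exact fun h => ha2 h.symm
      have hsh := norm_sepVec_exit_le_of_free hLipB hsymm ht hE htopK hstep hp hm'm hmK hba hfb hfa
      rw [abs_of_pos hu0] at hsh
      have hmul : (t (m + 1) - t (m' + 1)) * ‖(E m b).2 - (E m a).2‖ ≤
          δ * ‖(E m b).2 - (E m a).2‖ := mul_le_mul_of_nonneg_right huδ.le (norm_nonneg _)
      have hlow : ε ≤ ‖G.sepVec (E m b).1 (E m a).1‖ := (hp m hmK).mem_hardSphereDomain b a hba'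
      refine hmk1 (p m) (E m) a ha1 ha2 ?_
      rcases hb with rfl | rfl
      · exact Or.inl ⟨hlow, by linarith⟩
      · exact Or.inr ⟨hlow, by linarith⟩
  -- comparison of the two cardinalities with the two sums of the statement
  refine le_trans (b := (S.card : ℝ) + 3 * (T.card : ℝ)) (by exact_mod_cast key)
    (add_le_add ?_ (mul_le_mul_of_nonneg_left ?_ (by norm_num)))
  · -- shell pairs at the cell starts
    rw [hS, Finset.natCast_card_filter, Finset.sum_product]
  · -- marked counted collisions: `incomingPairs z_m♭ = {p m}`
    rw [hT, Finset.natCast_card_filter]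
    refine (Finset.sum_le_sum fun m hm => ?_).trans
      (Finset.sum_le_sum_of_subset_of_nonneg (fun m hm => ?_) fun m _ _ => ?_)
    · rw [Finset.mem_Ico] at hm
      have hak' : a' < (lambertInstant G ε ξs z (m + 1)).toReal := by
        rw [← ht]
        exact hak m hm.1 hm.2
      rw [if_pos hak', ← hE, (hp m hm.2).incomingPairs_eq, Finset.sum_eq_single (p m)]
      · rw [Set.indicator_of_mem (Set.mem_singleton _)]
        split_ifs with h
        · exact h
        · exact hmk0 _ _
      · exact fun q _ hq => Set.indicator_of_notMem (fun h => hq (Set.mem_singleton_iff.1 h)) _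
      · exact fun h => absurd (Finset.mem_univ _) h
    · rw [Finset.mem_range]
      exact (Finset.mem_Ico.1 hm).2
    · split_ifs
      · exact Finset.sum_nonneg fun q _ => Set.indicator_nonneg (fun _ _ => hmk0 _ _) _
      · exact le_rfl

end Summit.AtomisticToContinuum.HydrodynamicLimit.Theorems.LambertianContactSwapLambertianEulerCellChargingPath

end
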